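import Mathlib
import Literature.AlgebraicGeometry.Resolution.CobordantGame
import Literature.AlgebraicGeometry.Resolution.CobordantVertexChart
import Literature.AlgebraicGeometry.Resolution.FormalCoordinateChange
import Summits.ResolutionOfSingularities.ResolutionOfSingularities.Theorems.WeightedInvariantLocalWeightedDropGradedSliceRank
import Summits.ResolutionOfSingularities.ResolutionOfSingularities.Theorems.WeightedInvariantLocalWeightedDropTwistedTrivialWitnesses

/-!
# `WeightedInvariant.LocalWeightedDrop`: GRADED WINS ARE INSENSITIVE TO UNITS — the unit transfer of the graded game

Route `ResolutionOfSingularities/WeightedInvariant`, crux `LocalWeightedDrop` (stmt-ResolutionOfSingularities-8899).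
[OURS · L1 W4.3] — CHAIN w43 SEAT TABLE v7 row res-type-060 «idea-1's graded slices»; second of the three transfers through
which the surviving ONE-SIDED slice statement («slice graded-won ⇒ successor graded-won», tame case: the successor is a unit
times a graded coordinate change of the cylinder over its slice) factors — cylinder (`…GradedGameCylinder`,
`gradedWonBy_cylinder`), UNIT (this file), graded coordinate change (open).  Nothing here is a statement of the manuscript under
review on ladder RESOLUTION; not a verdict on card A.  AI proof, weaker than expert review.

* `isSuccessorAt_of_unit_mul` — SUCCESSORS OF `u·f` ARE UNIT MULTIPLES OF SUCCESSORS OF `f` (same move, same exceptional point,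
  same exponent; the unit is `U = u(θ)(chart_c)`, the `s`-saturation is unique — `eq_of_X_pow_mul_eq`; membership in `𝔪²` is a
  statement about the order, `FormalCoordChange.two_le_order_iff`, and units do not change it).
* `gradedWonBy_unit_mul` / `gradedWonBy_unit_mul_iff` — **`GradedWonBy α m L (u·f) ↔ GradedWonBy α m L f` for every unit
  `u`** (no grading condition on `u`: the game predicate only sees the moves and the singular successors); transfinite induction.
* tools `singular_iff_two_le_order`, `two_le_order_mul_of_right`, `two_le_order_unit_mul_iff`, `isUnit_subst`,
  `not_X_dvd_unit_mul`.
-/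

set_option linter.dupNamespace false -- mandated namespace of this single-conjunct summit
set_option autoImplicit false

namespace Summit.ResolutionOfSingularities.ResolutionOfSingularities.Theorems

namespace GradedGame

open MvPowerSeries
open Literature.AlgebraicGeometry.Resolution
open Literature.AlgebraicGeometry.Resolution.FormalCoordChange (two_le_order_iff)

variable {k : Type} [Field k]

/-- `g ∈ 𝔪²` is a statement about the order. [OURS · L1 W4.3] -/
theorem singular_iff_two_le_order {m : ℕ} (g : MvPowerSeries (Fin m) k) :
    (constantCoeff g = 0 ∧ ∀ j, coeff (Finsupp.single j 1) g = 0) ↔ 2 ≤ g.order :=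
  (two_le_order_iff g).symm

/-- Multiplication never lowers the order below that of a factor. [OURS · L1 W4.3] -/
theorem two_le_order_mul_of_right {m : ℕ} (u : MvPowerSeries (Fin m) k) {g : MvPowerSeries (Fin m) k} (h : 2 ≤ g.order) :
    2 ≤ (u * g).order :=
  h.trans (le_add_self.trans MvPowerSeries.le_order_mul)

/-- Multiplying by a unit keeps a germ in `𝔪²` and out of it. [OURS · L1 W4.3] -/
theorem two_le_order_unit_mul_iff {m : ℕ} {u : MvPowerSeries (Fin m) k} (hu : IsUnit u) (g : MvPowerSeries (Fin m) k) :
    2 ≤ (u * g).order ↔ 2 ≤ g.order := by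
  refine ⟨fun h => ?_, two_le_order_mul_of_right u⟩
  obtain ⟨v, rfl⟩ := hu
  have hg : g = (↑v⁻¹ : MvPowerSeries (Fin m) k) * (↑v * g) := by
    rw [← mul_assoc, Units.inv_mul, one_mul]
  rw [hg]
  exact two_le_order_mul_of_right _ h

/-- `s ∤ g`, `U` a unit ⇒ `s ∤ U·g`. [OURS · L1 W4.3] -/
theorem not_X_dvd_unit_mul {m : ℕ} {U g : MvPowerSeries (Fin (m + 1)) k} (hU : IsUnit U) (hg : ¬ X 0 ∣ g) :
    ¬ X 0 ∣ U * g := by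
  obtain ⟨v, rfl⟩ := hU
  intro h
  apply hg
  have : g = (↑v⁻¹ : MvPowerSeries (Fin (m + 1)) k) * (↑v * g) := by rw [← mul_assoc, Units.inv_mul, one_mul]
  rw [this]
  exact Dvd.dvd.mul_left h _

/-- **SUCCESSORS OF `u·f` ARE UNIT MULTIPLES OF SUCCESSORS OF `f`** (same move, same exceptional point, same exponent): the unit
is `U = u(θ)(chart_c)`, and the `s`-saturation is unique. [OURS · L1 W4.3] -/
theorem isSuccessorAt_of_unit_mul {m : ℕ} (f u : MvPowerSeries (Fin m) k) (hu : IsUnit u)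
    (θ : Fin m → MvPowerSeries (Fin m) k) (w : Fin m → ℕ) (h0 : ∀ i, constantCoeff (θ i) = 0) (c : Fin m → k) (a : ℕ)
    (g' : MvPowerSeries (Fin (m + 1)) k) (h : IsSuccessorAt (u * f) θ w c a g') :
    ∃ g : MvPowerSeries (Fin (m + 1)) k, IsSuccessorAt f θ w c a g ∧
      g' = subst (CobordantGame.cruxChart k w c) (subst θ u) * g := by
  obtain ⟨hoff, hfac, hndvd, hsing⟩ := h
  have hθs : HasSubst θ := hasSubst_of_constantCoeff_zero h0
  have hC := hasSubst_cruxChart (k := k) w c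
  set U := subst (CobordantGame.cruxChart k w c) (subst θ u) with hU
  have hUu : IsUnit U := isUnit_subst hC (isUnit_subst hθs hu)
  set T := subst (CobordantGame.cruxChart k w c) (subst θ f) with hT
  rw [subst_mul hθs, subst_mul hC, ← hU, ← hT] at hfac
  -- `hfac : U * T = X 0 ^ a * g'`
  have hTne : T ≠ 0 := by
    intro hz
    rw [hz, mul_zero] at hfac
    have hg' : g' = 0 := by
      rcases mul_eq_zero.mp hfac.symm with h1 | h1
      · exact absurd h1 (pow_ne_zero _ X_zero_ne_zero)
      · exact h1
    exact hndvd (hg' ▸ dvd_zero _)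
  obtain ⟨b, g, hTfac, hg⟩ := CobordantVertexChart.exists_eq_X_pow_mul_not_dvd hTne
  have hUT : U * T = X 0 ^ b * (U * g) := by rw [hTfac]; ring
  obtain ⟨hab, hgg⟩ := eq_of_X_pow_mul_eq (hUT.symm.trans hfac) (not_X_dvd_unit_mul hUu hg) hndvd
  refine ⟨g, ⟨hoff, ?_, hg, ?_⟩, hgg.symm⟩
  · rw [← hab]; exact hTfac
  · rw [singular_iff_two_le_order, ← two_le_order_unit_mul_iff hUu, hgg, ← singular_iff_two_le_order]
    exact hsing

/-- **GRADED WINS ARE INSENSITIVE TO UNITS, WITH THE SAME RANK**: `GradedWonBy α m L f → GradedWonBy α m L (u·f)` for every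
unit `u` (no grading condition on `u` is needed: the game predicate only sees the moves and the singular successors, and the
successors of `u·f` are unit multiples of those of `f`).  Transfinite induction on `α`.  Second third of the surviving one-sided
slice statement (tame case). [OURS · L1 W4.3] -/
theorem gradedWonBy_unit_mul (α : Ordinal.{0}) :
    ∀ {m : ℕ} (L : AddSubgroup (Fin m → ℤ)) (f u : MvPowerSeries (Fin m) k), IsUnit u →
      GradedWonBy α m L f → GradedWonBy α m L (u * f) := by
  induction α using WellFoundedLT.induction with
  | ind α ih =>
    intro m L f u hu h
    rw [gradedWonBy_iff] at h ⊢
    obtain ⟨θ, w, hθ, hs⟩ := h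
    refine ⟨θ, w, hθ, fun c a g' hg' => ?_⟩
    obtain ⟨g, hg, rfl⟩ := isSuccessorAt_of_unit_mul f u hu θ w hθ.1.1 c a g' hg'
    obtain ⟨β, hβ, hW⟩ := hs c a g hg
    have hθs : HasSubst θ := hasSubst_of_constantCoeff_zero hθ.1.1
    have hC := hasSubst_cruxChart (k := k) w c
    exact ⟨β, hβ, ih β hβ _ g _ (isUnit_subst hC (isUnit_subst hθs hu)) hW⟩

/-- … and conversely (divide by the unit). [OURS · L1 W4.3] -/
theorem gradedWonBy_unit_mul_iff (α : Ordinal.{0}) {m : ℕ} (L : AddSubgroup (Fin m → ℤ)) (f u : MvPowerSeries (Fin m) k)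
    (hu : IsUnit u) : GradedWonBy α m L (u * f) ↔ GradedWonBy α m L f := by
  refine ⟨fun h => ?_, gradedWonBy_unit_mul α L f u hu⟩
  obtain ⟨v, rfl⟩ := hu
  have hf : f = (↑v⁻¹ : MvPowerSeries (Fin m) k) * (↑v * f) := by rw [← mul_assoc, Units.inv_mul, one_mul]
  rw [hf]
  exact gradedWonBy_unit_mul α L _ _ (Units.isUnit _) h

end GradedGame

end Summit.ResolutionOfSingularities.ResolutionOfSingularities.Theorems
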